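import Literature.NumberTheory.LFunctions.DirichletLTruncationCertificatesOdd
import Literature.NumberTheory.LFunctions.DirichletLTruncationCertificatesMean
import HarnessLib

/-!
# No real zero for the ODD real primitive characters of conductor `1051 ≤ q ≤ 1100`, in the kernel
# (truncation certificates with drift)

Topic `Literature/NumberTheory/LFunctions`; namespace `Literature.NumberTheory.LFunctions`
(private per-modulus work in `Literature.NumberTheory.LFunctions.OddTruncationVb`). THEOREMS only (no
definition, no named fact, no `sorry`): **`noRealZeroOdd_range_1051_1100`** — for every modulus
`1051 ≤ q ≤ 1100`, every primitive quadratic ODD `χ` mod `q` (imaginary quadratic fields of discriminant `−q`)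
and every `σ ∈ (0, 1)`, `L(σ, χ) ≠ 0`.

Per modulus (one bullet each, in the order of `interval_cases`): moduli without a primitive quadratic
character are dismissed (`q ≡ 2 (mod 4)`, `16 ∣ q`, `p² ∣ q` — MV Thm 9.13); the EVEN primitive quadratic
character is excluded by the parity test inside `LTruncationCert.good_odd_of_*`; the ODD one is certified by
**`LTruncationCert.certDriftOK v q K J P`** (`DirichletLTruncationCertificatesOdd.lean`): the truncation
`∑_{n ≤ Kq} χ(n) n^{−σ}` after `K` periods dominates the one-sided second-order tail bound `B⁻/(2(Kq+1)^{3/2})`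
(`B⁻ = max_N (−U(N))⁺`; the drift `U(q) = q·h(−q) > 0` only helps) on each of `J` cells covering `[1/2, 1]`,
and the functional equation reflects `(0, 1/2)` to `(1/2, 1)`.  15 certificates in this file (parameters
and margins in the docstrings; `K > 1` / `J > 16` only where the one-period truncation is too small at
`σ = 1/2`). [cite: Chua2005RealZeros, §2.2 ALGO 1]

## References

* K. S. Chua, *Real zeros of Dedekind zeta functions of real quadratic fields*, Math. Comp. 74 (2005)
  1457–1470, §2. [Chua2005RealZeros]
* M. Watkins, *Real zeros of real odd Dirichlet L-functions*, Math. Comp. 73 (2004) 415–423.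
  [Watkins2004RealZeros]
* H. L. Montgomery, R. C. Vaughan, *Multiplicative Number Theory I*, CUP 2007, §9.3 Thm 9.13, §10.1.
  [MontgomeryVaughan2007]
-/

namespace Literature.NumberTheory.LFunctions

namespace OddTruncationVb

open FeketePolyaKernel PrimitiveQuadratic LTruncationCert

/-- Conductor `≡ 2 (mod 4)`: no primitive character (private copy of the sweep-4 lemma).
[cite: MontgomeryVaughan2007, §9.3 Theorem 9.13] -/
private theorem absurd_of_mod_four_two {q : ℕ} [NeZero q] (hq : q % 4 = 2)
    {χ : DirichletCharacter ℂ q} (hprim : χ.IsPrimitive) : False := by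
  obtain ⟨m, rfl⟩ : ∃ m, q = 2 * m := ⟨q / 2, by omega⟩
  haveI : NeZero m := ⟨by omega⟩
  exact not_isPrimitive_two_mul (m := m) (Nat.odd_iff.mpr (by omega)) hprim

/-- Conductor divisible by `16`: no primitive quadratic character (private copy).
[cite: MontgomeryVaughan2007, §9.3 Theorem 9.13] -/
private theorem absurd_of_sixteen_dvd {q : ℕ} [NeZero q] (hq : q % 16 = 0) {χ : DirichletCharacter ℂ q}
    (hprim : χ.IsPrimitive) (hquad : χ.IsQuadratic) : False := by
  obtain ⟨k, m, hm, rfl⟩ := Nat.exists_eq_two_pow_mul_odd (NeZero.ne q)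
  have hm2 := Nat.odd_iff.mp hm
  haveI : NeZero m := ⟨by omega⟩
  have hk := le_three_of_level_two_pow_mul hm hprim hquad
  interval_cases k <;> norm_num at hq <;> omega

/-- Conductor with an odd square factor `p²`: no primitive quadratic character (private copy).
[cite: MontgomeryVaughan2007, §9.3 Theorem 9.13] -/
private theorem absurd_of_sq_dvd {q : ℕ} [NeZero q] {p : ℕ} (hp : p.Prime) (hp2 : p ≠ 2)
    (hpq : p * p ∣ q) {χ : DirichletCharacter ℂ q} (hprim : χ.IsPrimitive) (hquad : χ.IsQuadratic) :
    False := by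
  obtain ⟨k, m, hm, rfl⟩ := Nat.exists_eq_two_pow_mul_odd (NeZero.ne q)
  have hm2 := Nat.odd_iff.mp hm
  haveI : NeZero m := ⟨by omega⟩
  have hsq := squarefree_of_level_two_pow_mul hm hprim hquad
  have hp2' : Nat.Coprime p 2 := (Nat.coprime_primes hp Nat.prime_two).mpr hp2
  have hcop : Nat.Coprime (p * p) (2 ^ k) := Nat.Coprime.pow_right k (Nat.Coprime.mul_left hp2' hp2')
  have hpm : p * p ∣ m := hcop.dvd_of_dvd_mul_left hpq
  exact hp.one_lt.ne' (Nat.isUnit_iff.mp (hsq p hpm))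

/-- `1051`: the odd character `(·/1051)` = `χ_{−1051}` — drift certificate `K = 1`, `J = 16`, `P = 32` (`B⁻ = 727`, worst cell margin `0.299`). [cite: Chua2005RealZeros, §2.2 ALGO 1] -/
private theorem goodOdd1051 :
    ∀ χ : DirichletCharacter ℂ 1051, χ.IsQuadratic → χ.IsPrimitive → χ.Odd →
      ∀ σ : ℝ, 0 < σ → σ < 1 → χ.LFunction σ ≠ 0 :=
  good_odd_of_odd (by decide) (by decide) 1 16 32 (by decide +kernel)

/-- `1055`: the odd character `(·/1055)` = `χ_{−1055}` — drift certificate `K = 1`, `J = 16`, `P = 32` (`B⁻ = 0`, worst cell margin `2.896`). [cite: Chua2005RealZeros, §2.2 ALGO 1] -/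
private theorem goodOdd1055 :
    ∀ χ : DirichletCharacter ℂ 1055, χ.IsQuadratic → χ.IsPrimitive → χ.Odd →
      ∀ σ : ℝ, 0 < σ → σ < 1 → χ.LFunction σ ≠ 0 :=
  good_odd_of_odd (by decide) (by decide) 1 16 32 (by decide +kernel)

/-- `1059`: the odd character `(·/1059)` = `χ_{−1059}` — drift certificate `K = 1`, `J = 16`, `P = 32` (`B⁻ = 264`, worst cell margin `0.372`). [cite: Chua2005RealZeros, §2.2 ALGO 1] -/
private theorem goodOdd1059 :
    ∀ χ : DirichletCharacter ℂ 1059, χ.IsQuadratic → χ.IsPrimitive → χ.Odd →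
      ∀ σ : ℝ, 0 < σ → σ < 1 → χ.LFunction σ ≠ 0 :=
  good_odd_of_odd (by decide) (by decide) 1 16 32 (by decide +kernel)

/-- `1060 = 4·265`: the odd character `χ₋₄·(·/265)` = `χ_{−1060}` — drift certificate `K = 1`, `J = 16`, `P = 32` (`B⁻ = 148`, worst cell margin `0.606`). [cite: Chua2005RealZeros, §2.2 ALGO 1] -/
private theorem goodOdd1060 :
    ∀ χ : DirichletCharacter ℂ 1060, χ.IsQuadratic → χ.IsPrimitive → χ.Odd →
      ∀ σ : ℝ, 0 < σ → σ < 1 → χ.LFunction σ ≠ 0 :=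
  good_odd_of_four (by decide) (by decide) 1 16 32 (by decide +kernel)

/-- `1063`: the odd character `(·/1063)` = `χ_{−1063}` — drift certificate `K = 1`, `J = 16`, `P = 32` (`B⁻ = 0`, worst cell margin `1.502`). [cite: Chua2005RealZeros, §2.2 ALGO 1] -/
private theorem goodOdd1063 :
    ∀ χ : DirichletCharacter ℂ 1063, χ.IsQuadratic → χ.IsPrimitive → χ.Odd →
      ∀ σ : ℝ, 0 < σ → σ < 1 → χ.LFunction σ ≠ 0 :=
  good_odd_of_odd (by decide) (by decide) 1 16 32 (by decide +kernel)

/-- `1064 = 8·133`: the odd character `χ₋₈·(·/133)` = `χ_{−1064}` — drift certificate `K = 1`, `J = 16`, `P = 32` (`B⁻ = 0`, worst cell margin `1.584`); the other primitive quadratic character mod `1064` is even (parity test). [cite: Chua2005RealZeros, §2.2 ALGO 1] -/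
private theorem goodOdd1064 :
    ∀ χ : DirichletCharacter ℂ 1064, χ.IsQuadratic → χ.IsPrimitive → χ.Odd →
      ∀ σ : ℝ, 0 < σ → σ < 1 → χ.LFunction σ ≠ 0 :=
  good_odd_of_eight (by decide) (by decide) 1 16 32 (by decide +kernel) (by decide +kernel)

/-- `1067`: the odd character `(·/1067)` = `χ_{−1067}` — drift certificate `K = 1`, `J = 16`, `P = 32` (`B⁻ = 0`, worst cell margin `0.942`). [cite: Chua2005RealZeros, §2.2 ALGO 1] -/
private theorem goodOdd1067 :
    ∀ χ : DirichletCharacter ℂ 1067, χ.IsQuadratic → χ.IsPrimitive → χ.Odd →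
      ∀ σ : ℝ, 0 < σ → σ < 1 → χ.LFunction σ ≠ 0 :=
  good_odd_of_odd (by decide) (by decide) 1 16 32 (by decide +kernel)

/-- `1076 = 4·269`: the odd character `χ₋₄·(·/269)` = `χ_{−1076}` — drift certificate `K = 1`, `J = 16`, `P = 32` (`B⁻ = 0`, worst cell margin `1.738`). [cite: Chua2005RealZeros, §2.2 ALGO 1] -/
private theorem goodOdd1076 :
    ∀ χ : DirichletCharacter ℂ 1076, χ.IsQuadratic → χ.IsPrimitive → χ.Odd →
      ∀ σ : ℝ, 0 < σ → σ < 1 → χ.LFunction σ ≠ 0 :=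
  good_odd_of_four (by decide) (by decide) 1 16 32 (by decide +kernel)

/-- `1079`: the odd character `(·/1079)` = `χ_{−1079}` — drift certificate `K = 1`, `J = 16`, `P = 32` (`B⁻ = 0`, worst cell margin `2.696`). [cite: Chua2005RealZeros, §2.2 ALGO 1] -/
private theorem goodOdd1079 :
    ∀ χ : DirichletCharacter ℂ 1079, χ.IsQuadratic → χ.IsPrimitive → χ.Odd →
      ∀ σ : ℝ, 0 < σ → σ < 1 → χ.LFunction σ ≠ 0 :=
  good_odd_of_odd (by decide) (by decide) 1 16 32 (by decide +kernel)

/-- `1087`: the odd character `(·/1087)` = `χ_{−1087}` — drift certificate `K = 1`, `J = 16`, `P = 32` (`B⁻ = 539`, worst cell margin `0.470`). [cite: Chua2005RealZeros, §2.2 ALGO 1] -/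
private theorem goodOdd1087 :
    ∀ χ : DirichletCharacter ℂ 1087, χ.IsQuadratic → χ.IsPrimitive → χ.Odd →
      ∀ σ : ℝ, 0 < σ → σ < 1 → χ.LFunction σ ≠ 0 :=
  good_odd_of_odd (by decide) (by decide) 1 16 32 (by decide +kernel)

/-- `1091`: the odd character `(·/1091)` = `χ_{−1091}` — drift certificate `K = 1`, `J = 16`, `P = 32` (`B⁻ = 0`, worst cell margin `1.333`). [cite: Chua2005RealZeros, §2.2 ALGO 1] -/
private theorem goodOdd1091 :
    ∀ χ : DirichletCharacter ℂ 1091, χ.IsQuadratic → χ.IsPrimitive → χ.Odd →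
      ∀ σ : ℝ, 0 < σ → σ < 1 → χ.LFunction σ ≠ 0 :=
  good_odd_of_odd (by decide) (by decide) 1 16 32 (by decide +kernel)

/-- `1092 = 4·273`: the odd character `χ₋₄·(·/273)` = `χ_{−1092}` — drift certificate `K = 1`, `J = 16`, `P = 32` (`B⁻ = 270`, worst cell margin `0.543`). [cite: Chua2005RealZeros, §2.2 ALGO 1] -/
private theorem goodOdd1092 :
    ∀ χ : DirichletCharacter ℂ 1092, χ.IsQuadratic → χ.IsPrimitive → χ.Odd →
      ∀ σ : ℝ, 0 < σ → σ < 1 → χ.LFunction σ ≠ 0 :=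
  good_odd_of_four (by decide) (by decide) 1 16 32 (by decide +kernel)

/-- `1095`: the odd character `(·/1095)` = `χ_{−1095}` — drift certificate `K = 1`, `J = 16`, `P = 32` (`B⁻ = 0`, worst cell margin `2.198`). [cite: Chua2005RealZeros, §2.2 ALGO 1] -/
private theorem goodOdd1095 :
    ∀ χ : DirichletCharacter ℂ 1095, χ.IsQuadratic → χ.IsPrimitive → χ.Odd →
      ∀ σ : ℝ, 0 < σ → σ < 1 → χ.LFunction σ ≠ 0 :=
  good_odd_of_odd (by decide) (by decide) 1 16 32 (by decide +kernel)

/-- `1096 = 8·137`: the odd character `χ₋₈·(·/137)` = `χ_{−1096}` — drift certificate `K = 1`, `J = 16`, `P = 32` (`B⁻ = 0`, worst cell margin `0.926`); the other primitive quadratic character mod `1096` is even (parity test). [cite: Chua2005RealZeros, §2.2 ALGO 1] -/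
private theorem goodOdd1096 :
    ∀ χ : DirichletCharacter ℂ 1096, χ.IsQuadratic → χ.IsPrimitive → χ.Odd →
      ∀ σ : ℝ, 0 < σ → σ < 1 → χ.LFunction σ ≠ 0 :=
  good_odd_of_eight (by decide) (by decide) 1 16 32 (by decide +kernel) (by decide +kernel)

/-- `1099`: the odd character `(·/1099)` = `χ_{−1099}` — drift certificate `K = 1`, `J = 16`, `P = 32` (`B⁻ = 490`, worst cell margin `0.429`). [cite: Chua2005RealZeros, §2.2 ALGO 1] -/
private theorem goodOdd1099 :
    ∀ χ : DirichletCharacter ℂ 1099, χ.IsQuadratic → χ.IsPrimitive → χ.Odd →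
      ∀ σ : ℝ, 0 < σ → σ < 1 → χ.LFunction σ ≠ 0 :=
  good_odd_of_odd (by decide) (by decide) 1 16 32 (by decide +kernel)

/-- **No real zero in `(0, 1)` for every odd real primitive character of conductor `1051 ≤ q ≤ 1100`**
(one bullet per modulus, in the order of `interval_cases`). [cite: Chua2005RealZeros, §2.2 ALGO 1] -/
theorem range_1051_1100 (q : ℕ) [NeZero q] (hlo : 1050 < q) (hhi : q ≤ 1100) :
    ∀ χ : DirichletCharacter ℂ q, χ.IsQuadratic → χ.IsPrimitive → χ.Odd →
      ∀ σ : ℝ, 0 < σ → σ < 1 → χ.LFunction σ ≠ 0 := by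
  interval_cases q
  · exact goodOdd1051 -- certificate
  · -- 1052 = 4·263, 263 ≡ 3 (mod 4): the primitive quadratic character is even (parity test)
    exact good_odd_of_four (by decide) (by decide) 1 16 32 (by decide +kernel)
  · -- 3² ∣ 1053: no primitive quadratic character
    exact fun χ hquad hprim _ ↦
      (absurd_of_sq_dvd (p := 3) (by norm_num) (by decide) (by decide) hprim hquad).elim
  · -- 1054 ≡ 2 (mod 4): no primitive character
    exact fun χ _ hprim _ ↦ (absurd_of_mod_four_two (by decide) hprim).elim
  · exact goodOdd1055 -- certificate
  · -- 16 ∣ 1056: no primitive quadratic character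
    exact fun χ hquad hprim _ ↦ (absurd_of_sixteen_dvd (by decide) hprim hquad).elim
  · -- 1057 ≡ 1 (mod 4): the primitive quadratic character (·/1057) is even (parity test)
    exact good_odd_of_odd (by decide) (by decide) 1 16 32 (by decide +kernel)
  · -- 1058 ≡ 2 (mod 4): no primitive character
    exact fun χ _ hprim _ ↦ (absurd_of_mod_four_two (by decide) hprim).elim
  · exact goodOdd1059 -- certificate
  · exact goodOdd1060 -- certificate
  · -- 1061 ≡ 1 (mod 4): the primitive quadratic character (·/1061) is even (parity test)
    exact good_odd_of_odd (by decide) (by decide) 1 16 32 (by decide +kernel)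
  · -- 1062 ≡ 2 (mod 4): no primitive character
    exact fun χ _ hprim _ ↦ (absurd_of_mod_four_two (by decide) hprim).elim
  · exact goodOdd1063 -- certificate
  · exact goodOdd1064 -- certificate
  · -- 1065 ≡ 1 (mod 4): the primitive quadratic character (·/1065) is even (parity test)
    exact good_odd_of_odd (by decide) (by decide) 1 16 32 (by decide +kernel)
  · -- 1066 ≡ 2 (mod 4): no primitive character
    exact fun χ _ hprim _ ↦ (absurd_of_mod_four_two (by decide) hprim).elim
  · exact goodOdd1067 -- certificate
  · -- 1068 = 4·267, 267 ≡ 3 (mod 4): the primitive quadratic character is even (parity test)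
    exact good_odd_of_four (by decide) (by decide) 1 16 32 (by decide +kernel)
  · -- 1069 ≡ 1 (mod 4): the primitive quadratic character (·/1069) is even (parity test)
    exact good_odd_of_odd (by decide) (by decide) 1 16 32 (by decide +kernel)
  · -- 1070 ≡ 2 (mod 4): no primitive character
    exact fun χ _ hprim _ ↦ (absurd_of_mod_four_two (by decide) hprim).elim
  · -- 3² ∣ 1071: no primitive quadratic character
    exact fun χ hquad hprim _ ↦
      (absurd_of_sq_dvd (p := 3) (by norm_num) (by decide) (by decide) hprim hquad).elim
  · -- 16 ∣ 1072: no primitive quadratic character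
    exact fun χ hquad hprim _ ↦ (absurd_of_sixteen_dvd (by decide) hprim hquad).elim
  · -- 1073 ≡ 1 (mod 4): the primitive quadratic character (·/1073) is even (parity test)
    exact good_odd_of_odd (by decide) (by decide) 1 16 32 (by decide +kernel)
  · -- 1074 ≡ 2 (mod 4): no primitive character
    exact fun χ _ hprim _ ↦ (absurd_of_mod_four_two (by decide) hprim).elim
  · -- 5² ∣ 1075: no primitive quadratic character
    exact fun χ hquad hprim _ ↦
      (absurd_of_sq_dvd (p := 5) (by norm_num) (by decide) (by decide) hprim hquad).elim
  · exact goodOdd1076 -- certificate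
  · -- 1077 ≡ 1 (mod 4): the primitive quadratic character (·/1077) is even (parity test)
    exact good_odd_of_odd (by decide) (by decide) 1 16 32 (by decide +kernel)
  · -- 1078 ≡ 2 (mod 4): no primitive character
    exact fun χ _ hprim _ ↦ (absurd_of_mod_four_two (by decide) hprim).elim
  · exact goodOdd1079 -- certificate
  · -- 3² ∣ 1080: no primitive quadratic character
    exact fun χ hquad hprim _ ↦
      (absurd_of_sq_dvd (p := 3) (by norm_num) (by decide) (by decide) hprim hquad).elim
  · -- 1081 ≡ 1 (mod 4): the primitive quadratic character (·/1081) is even (parity test)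
    exact good_odd_of_odd (by decide) (by decide) 1 16 32 (by decide +kernel)
  · -- 1082 ≡ 2 (mod 4): no primitive character
    exact fun χ _ hprim _ ↦ (absurd_of_mod_four_two (by decide) hprim).elim
  · -- 19² ∣ 1083: no primitive quadratic character
    exact fun χ hquad hprim _ ↦
      (absurd_of_sq_dvd (p := 19) (by norm_num) (by decide) (by decide) hprim hquad).elim
  · -- 1084 = 4·271, 271 ≡ 3 (mod 4): the primitive quadratic character is even (parity test)
    exact good_odd_of_four (by decide) (by decide) 1 16 32 (by decide +kernel)
  · -- 1085 ≡ 1 (mod 4): the primitive quadratic character (·/1085) is even (parity test)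
    exact good_odd_of_odd (by decide) (by decide) 1 16 32 (by decide +kernel)
  · -- 1086 ≡ 2 (mod 4): no primitive character
    exact fun χ _ hprim _ ↦ (absurd_of_mod_four_two (by decide) hprim).elim
  · exact goodOdd1087 -- certificate
  · -- 16 ∣ 1088: no primitive quadratic character
    exact fun χ hquad hprim _ ↦ (absurd_of_sixteen_dvd (by decide) hprim hquad).elim
  · -- 3² ∣ 1089: no primitive quadratic character
    exact fun χ hquad hprim _ ↦
      (absurd_of_sq_dvd (p := 3) (by norm_num) (by decide) (by decide) hprim hquad).elim
  · -- 1090 ≡ 2 (mod 4): no primitive character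
    exact fun χ _ hprim _ ↦ (absurd_of_mod_four_two (by decide) hprim).elim
  · exact goodOdd1091 -- certificate
  · exact goodOdd1092 -- certificate
  · -- 1093 ≡ 1 (mod 4): the primitive quadratic character (·/1093) is even (parity test)
    exact good_odd_of_odd (by decide) (by decide) 1 16 32 (by decide +kernel)
  · -- 1094 ≡ 2 (mod 4): no primitive character
    exact fun χ _ hprim _ ↦ (absurd_of_mod_four_two (by decide) hprim).elim
  · exact goodOdd1095 -- certificate
  · exact goodOdd1096 -- certificate
  · -- 1097 ≡ 1 (mod 4): the primitive quadratic character (·/1097) is even (parity test)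
    exact good_odd_of_odd (by decide) (by decide) 1 16 32 (by decide +kernel)
  · -- 1098 ≡ 2 (mod 4): no primitive character
    exact fun χ _ hprim _ ↦ (absurd_of_mod_four_two (by decide) hprim).elim
  · exact goodOdd1099 -- certificate
  · -- 5² ∣ 1100: no primitive quadratic character
    exact fun χ hquad hprim _ ↦
      (absurd_of_sq_dvd (p := 5) (by norm_num) (by decide) (by decide) hprim hquad).elim

end OddTruncationVb

open OddTruncationVb in
/-- **Odd real primitive characters of conductor `1051 ≤ q ≤ 1100` have no real zero in `(0, 1)`.**
[cite: Watkins2004RealZeros, main theorem (d ≤ 3·10⁸, here re-proved in the kernel for this range)] -/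
theorem noRealZeroOdd_range_1051_1100 (q : ℕ) [NeZero q] (hlo : 1050 < q) (hhi : q ≤ 1100) :
    ∀ χ : DirichletCharacter ℂ q, χ.IsQuadratic → χ.IsPrimitive → χ.Odd →
      ∀ σ : ℝ, 0 < σ → σ < 1 → χ.LFunction σ ≠ 0 :=
  range_1051_1100 q hlo hhi

end Literature.NumberTheory.LFunctions
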